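import Literature.AlgebraicGeometry.Motives.HodgeLieWeightOneGradingSymmetry
import Literature.AlgebraicGeometry.Motives.HodgeLieWeightOnePlusLineBlocks
import HarnessLib

/-!
# Weight one, `𝔥⁺ = ℂE`, trivial centre: the compact ideal `𝔨 = {K ∈ 𝔥_ℂ : K P = P K, K E = E K}` and the
# decomposition `𝔥_ℂ = ℂE ⊕ ℂF ⊕ ℂ(2P − 1) ⊕ 𝔨`

Family `hodge`, layer `Literature/AlgebraicGeometry/Motives`; THEOREMS ONLY (no definition, no named fact; D-0026).
Sequel of `HodgeLieWeightOnePlusLine` / `HodgeLieComplexCenter` for the cell `pub-hodgecm2` (COR-CM) lane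
MT-RANK-SEVEN-TYPEIII, seat `b27` (the type-III position `(dim 𝔤⁺, dim 𝔤⁻, dim 𝔤⁰) = (1, 1, 4)` of the rung
`dim MT(H¹X) = 7`).

SETTING.  `H` polarizable of weight `1`, graded basis `e` (degrees in `{0,1}`), `P = gradingEnd e deg`, `Θ = 2P − 1`,
`𝔤 = 𝔥_ℂ = H.hodgeLieC`, a rational `X ∈ 𝔥 ∖ End_Hdg(V)` with blocks `E = P X_ℂ (1 − P)`, `F = (1 − P) X_ℂ P`, the
plus-line hypotheses `(h⁺)`, `(h⁻)` of `HodgeLieWeightOnePlusLine` and `𝔷 = Lie Hg ∩ End_Hdg = 0` (so `𝔤` is centre-free,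
`HodgeLieComplexCenter`); then `E F = αP`, `F E = α(1−P)`,
`α ≠ 0` (`projE_mul_projF_eq_smul_of_plusLine_of_center_eq_bot`).  Over `ℝ` this is `Hg(ℝ)⁰ ∼ SL₂(ℝ) × SU(2)`: the
triple `𝔰 = ⟨E, F, Θ⟩` is the non-compact factor and its centraliser `𝔨` the compact one (Moonen–Zarhin (2.3) Type III).
No notion is introduced: `𝔨` is spelled `{K ∈ 𝔤 : K P = P K ∧ K E = E K}` in every statement.

* (operator algebra in the companion `HodgeLieWeightOnePlusLineBlocks`: an operator commuting with `P`, `E` commutes with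
  `F`; uniqueness of `cE + c'F + dΘ + K`; the trace table.)
* **`exists_decomposition_of_plusLine`** — every `Y ∈ 𝔤` is `cE + c'F + dΘ + K` with `K ∈ 𝔨`
  (`Y⁰ = Y − E_Y − F_Y` has `[Y⁰, E] = λE`; take `K = Y⁰ − (λ/2)Θ`); `commute_of_plusLine` — `𝔨` commutes with `F` and
  `Θ` (it is obviously closed under brackets); **`eq_zero_of_forall_commute_of_plusLine`** — `𝔨` is centre-free (an element of
  `𝔨` commuting with `𝔨` is central in `𝔤`); **`finrank_centraliser_add_three`** — `dim 𝔨 + 3 = dim 𝔥`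
  (so `dim 𝔨 = 3` when `dim 𝔥 = 6`).

## References

* [MoonenZarhin1999LowDim] B. Moonen, Yu. Zarhin, *Hodge classes on abelian varieties of low dimension*, Math. Ann. 315
  (1999), §2 (2.3) Type III.
* [Deligne1982HodgeCycles] P. Deligne, *Hodge cycles on abelian varieties*, LNM 900 (1982), I §3 (3.4–3.6).
* [FultonHarris1991] W. Fulton, J. Harris, *Representation Theory*, GTM 129 (1991), Lecture 11 (§11.1).
-/

noncomputable section

open scoped TensorProduct

namespace Literature.AlgebraicGeometry.Motives

universe u

/-! ## §2 The centraliser `𝔨` of `⟨E, F, Θ⟩` in `𝔥_ℂ` -/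

namespace HodgeStructure

open ProjectorBlocks Literature.RepresentationTheory.GeneralLinear

variable {V : Type u} [AddCommGroup V] [Module ℚ V] [Module.Finite ℚ V] [HodgeTensorFacts.{u, u}] {n : ℤ}
  {S : Type u} [Fintype S] [DecidableEq S] {deg : S → ℤ}

/-- **Every `Y ∈ 𝔥_ℂ` decomposes as `Y = cE + c'F + dΘ + K` with `K ∈ 𝔥_ℂ` commuting with `P` and `E`** (plus-line
hypotheses, weight one): `E_Y = P Y (1−P) = cE`, `F_Y = c'F`, the diagonal part `Y⁰ = Y − cE − c'F` commutes with `P`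
and has `[Y⁰, E] = λE` (again a plus-line element), and `K = Y⁰ − (λ/2)Θ`. [cite: MoonenZarhin1999LowDim, §2 (2.3)]
[cite: Deligne1982HodgeCycles, I §3 (proof of Prop. 3.4)] -/
theorem exists_decomposition_of_plusLine (H : HodgeStructure V n) (hn : n = 1)
    (e : Module.Basis S ℂ (ℂ ⊗[ℚ] V)) (hF : ∀ a, H.F a = Submodule.span ℂ (e '' {σ | a ≤ deg σ}))
    (hFc : ∀ a, complexConj (H.F a) = Submodule.span ℂ (e '' {σ | deg σ ≤ n - a}))
    (hdeg : ∀ σ, deg σ = 0 ∨ deg σ = 1) {X : Module.End ℚ V} (hX : X ∈ H.hodgeLie)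
    (hplus : ∀ Y ∈ H.hodgeLieC, ∃ c : ℂ,
      gradingEnd e deg * Y * (1 - gradingEnd e deg) = c • (gradingEnd e deg * X.baseChange ℂ * (1 - gradingEnd e deg)))
    (hminus : ∀ Y ∈ H.hodgeLieC, ∃ c : ℂ,
      (1 - gradingEnd e deg) * Y * gradingEnd e deg = c • ((1 - gradingEnd e deg) * X.baseChange ℂ * gradingEnd e deg))
    {Y : Module.End ℂ (ℂ ⊗[ℚ] V)} (hY : Y ∈ H.hodgeLieC) :
    ∃ (c c' d : ℂ) (Z : Module.End ℂ (ℂ ⊗[ℚ] V)), Z ∈ H.hodgeLieC ∧ Z * gradingEnd e deg = gradingEnd e deg * Z ∧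
      Z * (gradingEnd e deg * X.baseChange ℂ * (1 - gradingEnd e deg)) =
        (gradingEnd e deg * X.baseChange ℂ * (1 - gradingEnd e deg)) * Z ∧
      Y = c • (gradingEnd e deg * X.baseChange ℂ * (1 - gradingEnd e deg)) +
        c' • ((1 - gradingEnd e deg) * X.baseChange ℂ * gradingEnd e deg) + d • ((2 : ℂ) • gradingEnd e deg - 1) + Z := by
  classical
  set P := gradingEnd e deg with hP
  set Yx := X.baseChange ℂ with hYx
  set E := P * Yx * (1 - P) with hEdef
  set F := (1 - P) * Yx * P with hFdef
  have hPP : P * P = P := gradingEnd_mul_gradingEnd_of_deg e hdeg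
  have hPE : P * E = E := by rw [hEdef, ← mul_assoc, ← mul_assoc, hPP]
  have hEP : E * P = 0 := by rw [hEdef, mul_assoc (P * Yx) (1 - P) P, sub_mul, one_mul, hPP, sub_self, mul_zero]
  have hPF : P * F = 0 := by
    rw [hFdef, mul_assoc (1 - P) Yx P, ← mul_assoc P (1 - P) (Yx * P), mul_sub, mul_one, hPP, sub_self, zero_mul]
  have hFP : F * P = F := by rw [hFdef, mul_assoc ((1 - P) * Yx) P P, hPP]
  have hEQ : E * (1 - P) = E := by rw [mul_sub, mul_one, hEP, sub_zero]
  have hYM : Yx ∈ H.hodgeLieC := H.baseChange_mem_hodgeLieC hX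
  obtain ⟨hEM, hFM⟩ := projE_mem_hodgeLieC H e hF hFc hdeg hYM
  rw [← hP, ← hEdef] at hEM
  rw [← hP, ← hFdef] at hFM
  have hΘ' : (2 : ℂ) • P - 1 ∈ H.hodgeLieC := by
    have h := two_smul_gradingEnd_sub_mem_hodgeLieC H e hF hFc
    have h1 : ((n : ℤ) : ℂ) • (1 : Module.End ℂ (ℂ ⊗[ℚ] V)) = 1 := by rw [hn, Int.cast_one, one_smul]
    rw [h1] at h
    exact h
  obtain ⟨hΘE, -⟩ := theta_bracket hPE hEP hPF hFP
  clear_value P Yx E F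
  obtain ⟨c, hc⟩ := hplus Y hY
  obtain ⟨c', hc'⟩ := hminus Y hY
  obtain ⟨Y0, hY0def⟩ : ∃ T : Module.End ℂ (ℂ ⊗[ℚ] V), T = Y - c • E - c' • F := ⟨_, rfl⟩
  -- `Y⁰` commutes with `P`
  have h1 : Y0 * P = P * (Y * P) := by
    rw [hY0def, sub_mul, sub_mul, smul_mul_assoc, smul_mul_assoc, hEP, hFP, smul_zero, sub_zero, ← hc',
      mul_assoc (1 - P) Y P, sub_mul, one_mul, sub_sub_cancel]
  have h2 : P * Y0 = P * (Y * P) := by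
    rw [hY0def, mul_sub, mul_sub, mul_smul_comm, mul_smul_comm, hPE, hPF, smul_zero, sub_zero, ← hc, mul_sub, mul_one,
      sub_sub_cancel, mul_assoc]
  have hY0P : Y0 * P = P * Y0 := by rw [h1, h2]
  have hY0Q1 : Y0 * (1 - P) = (1 - P) * Y0 := by rw [mul_sub, sub_mul, mul_one, one_mul, hY0P]
  have hY0M : Y0 ∈ H.hodgeLieC := by
    rw [hY0def]
    exact H.hodgeLieC.sub_mem (H.hodgeLieC.sub_mem hY (H.hodgeLieC.smul_mem _ hEM)) (H.hodgeLieC.smul_mem _ hFM)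
  -- `[Y⁰, E] = λE`
  obtain ⟨lam, hlam⟩ := hplus _ (H.commutator_mem_hodgeLieC hY0M hEM)
  have keyE : P * (Y0 * E - E * Y0) * (1 - P) = Y0 * E - E * Y0 := by
    rw [mul_sub P (Y0 * E) (E * Y0), sub_mul (P * (Y0 * E)) (P * (E * Y0)) (1 - P), ← mul_assoc P Y0 E, ← hY0P,
      mul_assoc Y0 P E, hPE, mul_assoc Y0 E (1 - P), hEQ, ← mul_assoc P E Y0, hPE, mul_assoc E Y0 (1 - P), hY0Q1,
      ← mul_assoc E (1 - P) Y0, hEQ]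
  have hY0E : Y0 * E - E * Y0 = lam • E := by rw [← keyE]; exact hlam
  -- `K = Y⁰ − (λ/2) Θ`
  refine ⟨c, c', (2 : ℂ)⁻¹ * lam, Y0 - ((2 : ℂ)⁻¹ * lam) • ((2 : ℂ) • P - 1), ?_, ?_, ?_, ?_⟩
  · exact H.hodgeLieC.sub_mem hY0M (H.hodgeLieC.smul_mem _ hΘ')
  · rw [sub_mul, mul_sub, smul_mul_assoc, mul_smul_comm, hY0P, (mul_theta hPP).2, (mul_theta hPP).1]
  · have hΘE' : ((2 : ℂ) • P - 1) * E = E * ((2 : ℂ) • P - 1) + (2 : ℂ) • E := by rw [← hΘE]; abel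
    have hY0E' : Y0 * E = E * Y0 + lam • E := by rw [← hY0E]; abel
    have hs : (2 : ℂ)⁻¹ * lam * 2 = lam := by field_simp
    rw [sub_mul, mul_sub, smul_mul_assoc, mul_smul_comm, hΘE', hY0E', smul_add, smul_smul, hs]
    abel
  · rw [hY0def]
    abel

/-- **`𝔨` commutes with `F` and `Θ` and is closed under brackets** (`K ∈ 𝔥_ℂ`, `K P = P K`, `K E = E K`, under
`E F = αP`, `F E = α(1−P)` — i.e. plus-line and centre-free). [cite: MoonenZarhin1999LowDim, §2 (2.3)]
[cite: FultonHarris1991, Lecture 11 (§11.1)] -/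
theorem commute_of_plusLine (H : HodgeStructure V n) (ψ : H.Polarization) (hn : n = 1)
    (e : Module.Basis S ℂ (ℂ ⊗[ℚ] V)) (hF : ∀ a, H.F a = Submodule.span ℂ (e '' {σ | a ≤ deg σ}))
    (hFc : ∀ a, complexConj (H.F a) = Submodule.span ℂ (e '' {σ | deg σ ≤ n - a}))
    (hdeg : ∀ σ, deg σ = 0 ∨ deg σ = 1) {X : Module.End ℚ V} (hX : X ∈ H.hodgeLie) (hXE : X ∉ H.endAlg)
    (hplus : ∀ Y ∈ H.hodgeLieC, ∃ c : ℂ,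
      gradingEnd e deg * Y * (1 - gradingEnd e deg) = c • (gradingEnd e deg * X.baseChange ℂ * (1 - gradingEnd e deg)))
    (hminus : ∀ Y ∈ H.hodgeLieC, ∃ c : ℂ,
      (1 - gradingEnd e deg) * Y * gradingEnd e deg = c • ((1 - gradingEnd e deg) * X.baseChange ℂ * gradingEnd e deg))
    (hz : H.hodgeLie ⊓ Subalgebra.toSubmodule H.endAlg = ⊥)
    {Z : Module.End ℂ (ℂ ⊗[ℚ] V)} (hZP : Z * gradingEnd e deg = gradingEnd e deg * Z)
    (hZE : Z * (gradingEnd e deg * X.baseChange ℂ * (1 - gradingEnd e deg)) =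
      (gradingEnd e deg * X.baseChange ℂ * (1 - gradingEnd e deg)) * Z) :
    Z * ((1 - gradingEnd e deg) * X.baseChange ℂ * gradingEnd e deg) =
        ((1 - gradingEnd e deg) * X.baseChange ℂ * gradingEnd e deg) * Z ∧
      Z * ((2 : ℂ) • gradingEnd e deg - 1) = ((2 : ℂ) • gradingEnd e deg - 1) * Z := by
  classical
  obtain ⟨α, hα, hEF, hFE, -⟩ :=
    projE_mul_projF_eq_smul_of_plusLine_of_center_eq_bot H ψ hn e hF hFc hdeg hX hXE hplus hminus hz
  set P := gradingEnd e deg with hP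
  set Yx := X.baseChange ℂ with hYx
  set E := P * Yx * (1 - P) with hEdef
  set F := (1 - P) * Yx * P with hFdef
  have hPP : P * P = P := gradingEnd_mul_gradingEnd_of_deg e hdeg
  have hPE : P * E = E := by rw [hEdef, ← mul_assoc, ← mul_assoc, hPP]
  have hEP : E * P = 0 := by rw [hEdef, mul_assoc (P * Yx) (1 - P) P, sub_mul, one_mul, hPP, sub_self, mul_zero]
  have hPF : P * F = 0 := by
    rw [hFdef, mul_assoc (1 - P) Yx P, ← mul_assoc P (1 - P) (Yx * P), mul_sub, mul_one, hPP, sub_self, zero_mul]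
  have hFP : F * P = F := by rw [hFdef, mul_assoc ((1 - P) * Yx) P P, hPP]
  obtain ⟨-, hFF⟩ := SL2Triple.mul_self_eq_zero hPE hEP hPF hFP
  refine ⟨commute_projF_of_commute hα hFP hFF hEF hFE hZP hZE, ?_⟩
  rw [mul_sub, sub_mul, mul_smul_comm, smul_mul_assoc, mul_one, one_mul, hZP]

/-- **`𝔨` is centre-free**: an element of `𝔥_ℂ` commuting with `P`, `E` and with every element of `𝔥_ℂ` that commutes
with `P` and `E` commutes with all of `𝔥_ℂ = ℂE ⊕ ℂF ⊕ ℂΘ ⊕ 𝔨`, hence vanishes when `𝔥_ℂ` is centre-free.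
[cite: MoonenZarhin1999LowDim, §2 (2.3)] [cite: Deligne1982HodgeCycles, I §3 (proof of Prop. 3.4)] -/
theorem eq_zero_of_forall_commute_of_plusLine (H : HodgeStructure V n) (ψ : H.Polarization) (hn : n = 1)
    (e : Module.Basis S ℂ (ℂ ⊗[ℚ] V)) (hF : ∀ a, H.F a = Submodule.span ℂ (e '' {σ | a ≤ deg σ}))
    (hFc : ∀ a, complexConj (H.F a) = Submodule.span ℂ (e '' {σ | deg σ ≤ n - a}))
    (hdeg : ∀ σ, deg σ = 0 ∨ deg σ = 1) {X : Module.End ℚ V} (hX : X ∈ H.hodgeLie) (hXE : X ∉ H.endAlg)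
    (hplus : ∀ Y ∈ H.hodgeLieC, ∃ c : ℂ,
      gradingEnd e deg * Y * (1 - gradingEnd e deg) = c • (gradingEnd e deg * X.baseChange ℂ * (1 - gradingEnd e deg)))
    (hminus : ∀ Y ∈ H.hodgeLieC, ∃ c : ℂ,
      (1 - gradingEnd e deg) * Y * gradingEnd e deg = c • ((1 - gradingEnd e deg) * X.baseChange ℂ * gradingEnd e deg))
    (hz : H.hodgeLie ⊓ Subalgebra.toSubmodule H.endAlg = ⊥)
    {Z : Module.End ℂ (ℂ ⊗[ℚ] V)} (hZ : Z ∈ H.hodgeLieC) (hZP : Z * gradingEnd e deg = gradingEnd e deg * Z)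
    (hZE : Z * (gradingEnd e deg * X.baseChange ℂ * (1 - gradingEnd e deg)) =
      (gradingEnd e deg * X.baseChange ℂ * (1 - gradingEnd e deg)) * Z)
    (hZc : ∀ Z' ∈ H.hodgeLieC, Z' * gradingEnd e deg = gradingEnd e deg * Z' →
      Z' * (gradingEnd e deg * X.baseChange ℂ * (1 - gradingEnd e deg)) =
        (gradingEnd e deg * X.baseChange ℂ * (1 - gradingEnd e deg)) * Z' → Z * Z' = Z' * Z) :
    Z = 0 := by
  obtain ⟨hZF, hZΘ⟩ := commute_of_plusLine H ψ hn e hF hFc hdeg hX hXE hplus hminus hz hZP hZE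
  refine eq_zero_of_mem_hodgeLieC_of_forall_commute H hz hZ fun Y hY => ?_
  obtain ⟨c, c', d, Z', hZ'M, hZ'P, hZ'E, hYdec⟩ := exists_decomposition_of_plusLine H hn e hF hFc hdeg hX hplus hminus hY
  rw [hYdec, mul_add, mul_add, mul_add, add_mul, add_mul, add_mul, mul_smul_comm, mul_smul_comm, mul_smul_comm,
    smul_mul_assoc, smul_mul_assoc, smul_mul_assoc, hZE, hZF, hZΘ, hZc Z' hZ'M hZ'P hZ'E]

/-- **`dim 𝔨 + 3 = dim 𝔥`** for the centraliser `𝔨 = {K ∈ 𝔥_ℂ : K P = P K, K E = E K}` in the plus-line position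
(`𝔥_ℂ = ℂE ⊕ ℂF ⊕ ℂΘ ⊕ 𝔨`, and `dim_ℂ 𝔥_ℂ = dim_ℚ 𝔥`); with `dim 𝔥 = 6`: `dim 𝔨 = 3`.
[cite: MoonenZarhin1999LowDim, §2 (2.3)] [cite: Deligne1982HodgeCycles, I §3 (proof of Prop. 3.4)] -/
theorem finrank_centraliser_add_three (H : HodgeStructure V n) (hn : n = 1)
    (e : Module.Basis S ℂ (ℂ ⊗[ℚ] V)) (hF : ∀ a, H.F a = Submodule.span ℂ (e '' {σ | a ≤ deg σ}))
    (hFc : ∀ a, complexConj (H.F a) = Submodule.span ℂ (e '' {σ | deg σ ≤ n - a}))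
    (hdeg : ∀ σ, deg σ = 0 ∨ deg σ = 1) {X : Module.End ℚ V} (hX : X ∈ H.hodgeLie) (hXE : X ∉ H.endAlg)
    (hplus : ∀ Y ∈ H.hodgeLieC, ∃ c : ℂ,
      gradingEnd e deg * Y * (1 - gradingEnd e deg) = c • (gradingEnd e deg * X.baseChange ℂ * (1 - gradingEnd e deg)))
    (hminus : ∀ Y ∈ H.hodgeLieC, ∃ c : ℂ,
      (1 - gradingEnd e deg) * Y * gradingEnd e deg = c • ((1 - gradingEnd e deg) * X.baseChange ℂ * gradingEnd e deg)) :
    Module.finrank ℂ (H.hodgeLieC ⊓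
        Module.End.eigenspace (LinearMap.mulLeft ℂ (gradingEnd e deg) - LinearMap.mulRight ℂ (gradingEnd e deg)) 0 ⊓
        Module.End.eigenspace (LinearMap.mulLeft ℂ (gradingEnd e deg * X.baseChange ℂ * (1 - gradingEnd e deg)) -
          LinearMap.mulRight ℂ (gradingEnd e deg * X.baseChange ℂ * (1 - gradingEnd e deg))) 0 : Submodule ℂ _) + 3 =
      Module.finrank ℚ H.hodgeLie := by
  classical
  obtain ⟨hE0, hF0⟩ := projE_ne_zero_of_not_mem_endAlg H hn e hF hFc hdeg hXE
  have hPP : gradingEnd e deg * gradingEnd e deg = gradingEnd e deg := gradingEnd_mul_gradingEnd_of_deg e hdeg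
  have hYM : X.baseChange ℂ ∈ H.hodgeLieC := H.baseChange_mem_hodgeLieC hX
  obtain ⟨hEM, hFM⟩ := projE_mem_hodgeLieC H e hF hFc hdeg hYM
  have hΘ' : (2 : ℂ) • gradingEnd e deg - 1 ∈ H.hodgeLieC := by
    have h := two_smul_gradingEnd_sub_mem_hodgeLieC H e hF hFc
    have h1 : ((n : ℤ) : ℂ) • (1 : Module.End ℂ (ℂ ⊗[ℚ] V)) = 1 := by rw [hn, Int.cast_one, one_smul]
    rw [h1] at h
    exact h
  set P := gradingEnd e deg with hP
  set E := P * X.baseChange ℂ * (1 - P) with hEdef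
  set F := (1 - P) * X.baseChange ℂ * P with hFdef
  set 𝔨 : Submodule ℂ (Module.End ℂ (ℂ ⊗[ℚ] V)) := H.hodgeLieC ⊓
    Module.End.eigenspace (LinearMap.mulLeft ℂ P - LinearMap.mulRight ℂ P) 0 ⊓
    Module.End.eigenspace (LinearMap.mulLeft ℂ E - LinearMap.mulRight ℂ E) 0 with h𝔨
  have hmem : ∀ Z, Z ∈ 𝔨 ↔ Z ∈ H.hodgeLieC ∧ Z * P = P * Z ∧ Z * E = E * Z := fun Z => by
    rw [h𝔨, Submodule.mem_inf, Submodule.mem_inf, mem_eigenspace_adP_zero_iff, mem_eigenspace_adP_zero_iff]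
    constructor
    · rintro ⟨⟨h1, h2⟩, h3⟩; exact ⟨h1, h2.symm, h3.symm⟩
    · rintro ⟨h1, h2, h3⟩; exact ⟨⟨h1, h2.symm⟩, h3.symm⟩
  have hPE : P * E = E := by rw [hEdef, ← mul_assoc, ← mul_assoc, hPP]
  have hEP : E * P = 0 := by
    rw [hEdef, mul_assoc (P * X.baseChange ℂ) (1 - P) P, sub_mul, one_mul, hPP, sub_self, mul_zero]
  have hPF : P * F = 0 := by
    rw [hFdef, mul_assoc (1 - P) (X.baseChange ℂ) P, ← mul_assoc P (1 - P), mul_sub, mul_one, hPP, sub_self, zero_mul]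
  have hFP : F * P = F := by rw [hFdef, mul_assoc ((1 - P) * X.baseChange ℂ) P P, hPP]
  -- the span `S` of `E, F, Θ`
  set Sp : Submodule ℂ (Module.End ℂ (ℂ ⊗[ℚ] V)) := Submodule.span ℂ {E, F, (2 : ℂ) • P - 1} with hSp
  have hSle : Sp ≤ H.hodgeLieC := by
    rw [hSp, Submodule.span_le]
    intro T hT
    simp only [Set.mem_insert_iff, Set.mem_singleton_iff] at hT
    rcases hT with rfl | rfl | rfl
    · exact hEM
    · exact hFM
    · exact hΘ'
  have h𝔨le : 𝔨 ≤ H.hodgeLieC := fun Z hZ => ((hmem Z).1 hZ).1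
  -- `𝔥_ℂ = S ⊔ 𝔨`
  have hsup : Sp ⊔ 𝔨 = H.hodgeLieC := by
    refine le_antisymm (sup_le hSle h𝔨le) fun Y hY => ?_
    obtain ⟨c, c', d, Z, hZM, hZP, hZE, hYdec⟩ :=
      exists_decomposition_of_plusLine H hn e hF hFc hdeg hX hplus hminus hY
    rw [← hP] at hZP hZE hYdec
    rw [← hEdef] at hZE hYdec
    rw [← hFdef] at hYdec
    rw [hYdec]
    refine Submodule.add_mem _ (Submodule.mem_sup_left ?_) (Submodule.mem_sup_right ((hmem Z).2 ⟨hZM, hZP, hZE⟩))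
    refine Submodule.add_mem _ (Submodule.add_mem _ (Submodule.smul_mem _ _ (Submodule.subset_span (by simp)))
      (Submodule.smul_mem _ _ (Submodule.subset_span (by simp)))) (Submodule.smul_mem _ _ (Submodule.subset_span (by simp)))
  -- `S ⊓ 𝔨 = 0`
  have hinf : Sp ⊓ 𝔨 = ⊥ := by
    rw [Submodule.eq_bot_iff]
    intro T hT
    obtain ⟨hTS', hT𝔨⟩ := Submodule.mem_inf.1 hT
    obtain ⟨hTM, hTP, hTE⟩ := (hmem T).1 hT𝔨
    have hTS : T ∈ Submodule.span ℂ {E, F, (2 : ℂ) • P - 1} := hTS'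
    rw [Submodule.mem_span_insert] at hTS
    obtain ⟨c, T₁, hT₁, rfl⟩ := hTS
    rw [Submodule.mem_span_insert] at hT₁
    obtain ⟨c', T₂, hT₂, rfl⟩ := hT₁
    rw [Submodule.mem_span_singleton] at hT₂
    obtain ⟨d, rfl⟩ := hT₂
    have h0 : (-c) • E + (-c') • F + (-d) • ((2 : ℂ) • P - 1) + (c • E + (c' • F + d • ((2 : ℂ) • P - 1))) = 0 := by
      module
    exact (eq_zero_of_combination_eq_zero hPP hPE hEP hPF hFP hE0 hF0 hTP hTE h0).2.2.2
  -- `dim S = 3`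
  have hSrank : Module.finrank ℂ Sp = 3 := by
    have hli : LinearIndependent ℂ ![E, F, (2 : ℂ) • P - 1] := by
      rw [Fintype.linearIndependent_iff]
      intro g hg i
      rw [Fin.sum_univ_three] at hg
      simp only [Matrix.cons_val_zero, Matrix.cons_val_one, Matrix.cons_val] at hg
      have hg' : g 0 • E + g 1 • F + g 2 • ((2 : ℂ) • P - 1) + 0 = 0 := by rw [add_zero]; exact hg
      obtain ⟨h0, h1, h2, -⟩ := eq_zero_of_combination_eq_zero hPP hPE hEP hPF hFP hE0 hF0
        (by rw [zero_mul, mul_zero]) (by rw [zero_mul, mul_zero]) hg'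
      fin_cases i
      · exact h0
      · exact h1
      · exact h2
    have hrange : Set.range ![E, F, (2 : ℂ) • P - 1] = {E, F, (2 : ℂ) • P - 1} := by
      rw [Matrix.range_cons, Matrix.range_cons, Matrix.range_cons, Matrix.range_empty, Set.union_empty]
      simp only [Set.singleton_union]
    rw [hSp, ← hrange, finrank_span_eq_card hli, Fintype.card_fin]
  have hdim := Submodule.finrank_sup_add_finrank_inf_eq Sp 𝔨
  rw [hinf, finrank_bot, add_zero, hsup, hSrank, finrank_hodgeLieC] at hdim
  omega

end HodgeStructure

end Literature.AlgebraicGeometry.Motives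

end
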